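import Summits.CriticalPhenomena.PercolationContinuityZ3.Theorems.PercNearOneGluingNoHeavyPcintMemoryTailLaw
import HarnessLib

/-!
# CriticalPhenomena/PercolationContinuityZ3 — Theorems/PercNearOneGluingNoHeavyPcintMemCountBinomial.lean: the memory-τ word counts are BINOMIAL POLYNOMIALS in the dimension — `c_{n,τ}(ℤ^d) = Σ_j C(d,j)·E_{τ,n,j}` for every `d`

Lane prim-pcint, STRUCTURE rule (prim-pcint-2 GEN 19).  The fact used informally throughout the lane (`p_n(ℤ^d) = Σ_k e_k C(d,k)`, P21c) and
needed to extend the uniform memory certificates DOWN to `d = τ/2` (gen19/README §4): relabelling the axes of a step word by an injection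
`ι : Fin j ↪ Fin d` preserves the memory-`τ` property (`isMem_relabel_iff`), the words of `ℤ^d` using exactly the axis set `A` (`|A| = j`)
are in bijection with the words of `ℤ^j` using all axes, so
**`memCount d τ n = Σ_{j=0}^{n} C(d, j) · fullMemCount j τ n`** for EVERY `d` (`memCount_eq_sum_choose`), where `fullMemCount j τ n` is the number
of memory-`τ` words of length `n` on `ℤ^j` that use all `j` axes (zero for `j > n`).  In particular `d ↦ memCount d τ n` is (the restriction to
`ℕ` of) a polynomial of degree `≤ n`.

HONEST FRAMING: elementary combinatorics (axis relabelling); no `sorry`; standard axioms.  Written by prim-pcint-2 gen 19, 2026-08-26.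
-/

noncomputable section

open Literature.Probability.LatticeModels Literature.Probability.Percolation
open Summit.CriticalPhenomena.PercolationContinuityZ3.Theorems.Pcint

namespace Summit.CriticalPhenomena.PercolationContinuityZ3.Theorems.Pcint.MemoryTail

variable {j d n : ℕ}

/-! ### Relabelling the axes -/

/-- Relabel the axes of a step word along `ι : Fin j → Fin d`. [folklore] -/
def relabel (ι : Fin j → Fin d) (u : Fin n → Fin j × Bool) : Fin n → Fin d × Bool := fun t => (ι (u t).1, (u t).2)

/-- Push a site of `ℤ^j` forward along `ι` (coordinate `a` goes to coordinate `ι a`; other coordinates `0`), as an additive map. [folklore] -/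
def embedSite (ι : Fin j → Fin d) : Site j →+ Site d where
  toFun x := fun v => ∑ a : Fin j, if ι a = v then x a else 0
  map_zero' := by funext v; simp
  map_add' x y := by funext v; simp only [Pi.add_apply, ← Finset.sum_add_distrib]; congr 1; funext a; split_ifs <;> simp

/-- Value at an image coordinate (injective `ι`). [folklore] -/
theorem embedSite_apply_image {ι : Fin j → Fin d} (hι : Function.Injective ι) (x : Site j) (a : Fin j) :
    embedSite ι x (ι a) = x a := by
  show (∑ a' : Fin j, if ι a' = ι a then x a' else 0) = x a
  rw [Finset.sum_eq_single a (fun b _ hb => by simp [hι.ne hb]) (fun h => absurd (Finset.mem_univ a) h)]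
  simp

/-- Value off the image is `0`. [folklore] -/
theorem embedSite_apply_of_forall_ne {ι : Fin j → Fin d} (x : Site j) {v : Fin d} (hv : ∀ a, ι a ≠ v) :
    embedSite ι x v = 0 := by
  show (∑ a' : Fin j, if ι a' = v then x a' else 0) = 0
  exact Finset.sum_eq_zero fun a _ => by simp [hv a]

/-- `embedSite` is injective for injective `ι`. [folklore] -/
theorem embedSite_injective {ι : Fin j → Fin d} (hι : Function.Injective ι) : Function.Injective (embedSite ι) := by
  intro x y h
  funext a
  have := congrFun h (ι a)
  rwa [embedSite_apply_image hι, embedSite_apply_image hι] at this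

/-- A unit step is pushed to the unit step on the image axis. [folklore] -/
theorem embedSite_stepVec {ι : Fin j → Fin d} (hι : Function.Injective ι) (e : Fin j × Bool) :
    embedSite ι (stepVec e) = stepVec (ι e.1, e.2) := by
  rcases e with ⟨a, b⟩
  funext v
  by_cases hv : ∃ a', ι a' = v
  · obtain ⟨a', rfl⟩ := hv
    rw [embedSite_apply_image hι]
    by_cases haa : a' = a
    · subst haa; cases b <;> simp [stepVec]
    · have : ι a' ≠ ι a := hι.ne haa
      cases b <;> simp [stepVec, haa, this]
  · push Not at hv
    rw [embedSite_apply_of_forall_ne _ hv]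
    have : v ≠ ι a := fun h => hv a h.symm
    cases b <;> simp [stepVec, this]

/-- **Positions transform by the push-forward**: `wordPos (relabel ι u) k = embedSite ι (wordPos u k)`. [folklore] -/
theorem wordPos_relabel {ι : Fin j → Fin d} (hι : Function.Injective ι) (u : Fin n → Fin j × Bool) (k : ℕ) :
    wordPos (relabel ι u) k = embedSite ι (wordPos u k) := by
  unfold wordPos
  rw [map_sum]
  refine Finset.sum_congr rfl fun i _ => ?_
  split_ifs with h
  · rw [embedSite_stepVec hι]; rfl
  · simp

/-- **Relabelling preserves the memory-`τ` property** (injective `ι`). [folklore] -/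
theorem isMem_relabel_iff {τ : ℕ} {ι : Fin j → Fin d} (hι : Function.Injective ι) (u : Fin n → Fin j × Bool) :
    IsMem τ (relabel ι u) ↔ IsMem τ u := by
  unfold IsMem
  simp only [wordPos_relabel hι, (embedSite_injective hι).ne_iff]

/-! ### Words using exactly a given set of axes -/

/-- The set of axes used by a word. [folklore] -/
def axes (w : Fin n → Fin d × Bool) : Finset (Fin d) := Finset.univ.image fun t => (w t).1

/-- A word of length `n` uses at most `n` axes. [folklore] -/
theorem card_axes_le (w : Fin n → Fin d × Bool) : (axes w).card ≤ n := by
  unfold axes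
  exact Finset.card_image_le.trans (by simp)

/-- Axes of a relabelled word. [folklore] -/
theorem axes_relabel (ι : Fin j → Fin d) (u : Fin n → Fin j × Bool) : axes (relabel ι u) = (axes u).image ι := by
  unfold axes relabel
  rw [Finset.image_image]
  rfl

open Classical in
/-- **`E_{τ,n,j}`**: the number of memory-`τ` words of length `n` on `ℤ^j` that use ALL `j` axes. [folklore] -/
def fullMemCount (j τ n : ℕ) : ℕ := ((memWords j τ n).filter fun u => axes u = Finset.univ).card

/-- `E_{τ,n,j} = 0` for `j > n`. [folklore] -/
theorem fullMemCount_eq_zero_of_lt {τ : ℕ} (hj : n < j) : fullMemCount j τ n = 0 := by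
  classical
  unfold fullMemCount
  rw [Finset.card_eq_zero, Finset.filter_eq_empty_iff]
  intro u _ hu
  have h1 := card_axes_le u
  rw [hu, Finset.card_univ, Fintype.card_fin] at h1
  omega

open Classical in
/-- **The words of `ℤ^d` using exactly the axis set `A` are counted by `E_{τ,n,|A|}`** (relabelling bijection along the increasing
enumeration of `A`). [folklore] -/
theorem card_filter_axes_eq {τ : ℕ} (A : Finset (Fin d)) :
    ((memWords d τ n).filter fun w => axes w = A).card = fullMemCount A.card τ n := by
  -- the increasing enumeration `ι : Fin |A| → Fin d` of `A` and its inverse on `A`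
  set m := A.card with hm
  let e : Fin m ≃o (A : Set (Fin d)) := A.orderIsoOfFin rfl
  let ι : Fin m → Fin d := fun a => (e a : Fin d)
  have hιmem : ∀ a, ι a ∈ A := fun a => (e a).2
  have hι : Function.Injective ι := fun a b h => e.injective (Subtype.ext h)
  have hsurj : ∀ v ∈ A, ∃ a, ι a = v := fun v hv => ⟨e.symm ⟨v, hv⟩, by simp [ι]⟩
  unfold fullMemCount
  symm
  refine Finset.card_bij (fun u _ => relabel ι u) ?_ ?_ ?_
  · -- maps into
    intro u hu
    rw [Finset.mem_filter, mem_memWords] at hu ⊢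
    refine ⟨(isMem_relabel_iff hι u).2 hu.1, ?_⟩
    rw [axes_relabel, hu.2]
    ext v
    simp only [Finset.mem_image, Finset.mem_univ, true_and]
    exact ⟨fun ⟨a, ha⟩ => ha ▸ hιmem a, fun hv => hsurj v hv⟩
  · -- injective
    intro u₁ _ u₂ _ h
    funext t
    have ht := congrFun h t
    simp only [relabel, Prod.mk.injEq] at ht
    exact Prod.ext (hι ht.1) ht.2
  · -- surjective
    intro w hw
    rw [Finset.mem_filter, mem_memWords] at hw
    have hwt : ∀ t, (w t).1 ∈ A := fun t => by
      rw [← hw.2]; exact Finset.mem_image_of_mem _ (Finset.mem_univ t)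
    let u : Fin n → Fin m × Bool := fun t => (e.symm ⟨(w t).1, hwt t⟩, (w t).2)
    have hwu : relabel ι u = w := by
      funext t
      simp [relabel, u, ι]
    refine ⟨u, ?_, hwu⟩
    rw [Finset.mem_filter, mem_memWords]
    constructor
    · rw [← isMem_relabel_iff hι u, hwu]; exact hw.1
    · -- all axes of `Fin m` are used
      ext a
      simp only [Finset.mem_univ, iff_true, axes, Finset.mem_image, true_and]
      have ha : ι a ∈ axes w := by rw [hw.2]; exact hιmem a
      obtain ⟨t, -, ht⟩ := Finset.mem_image.1 ha
      refine ⟨t, ?_⟩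
      show e.symm ⟨(w t).1, hwt t⟩ = a
      apply e.injective
      rw [OrderIso.apply_symm_apply]
      exact Subtype.ext ht

/-- **The binomial expansion**: `memCount d τ n = Σ_{j ≤ n} C(d, j)·E_{τ,n,j}` for EVERY `d`. [folklore] -/
theorem memCount_eq_sum_choose (d τ n : ℕ) :
    memCount d τ n = ∑ j ∈ Finset.range (n + 1), d.choose j * fullMemCount j τ n := by
  classical
  unfold memCount
  -- split by the set of axes used
  rw [Finset.card_eq_sum_card_fiberwise (f := axes) (t := (Finset.univ : Finset (Fin d)).powerset)
    (fun w _ => Finset.mem_powerset.2 (Finset.subset_univ _))]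
  simp_rw [card_filter_axes_eq]
  have hpc := Finset.sum_powerset_apply_card (fun c => fullMemCount c τ n) (x := (Finset.univ : Finset (Fin d)))
  simp only [Finset.card_univ, Fintype.card_fin, smul_eq_mul] at hpc
  rw [hpc]
  -- both sides are the sum over all `j` of `C(d,j)·E_j` (terms vanish for `j > d` resp. `j > n`)
  have key : ∀ N : ℕ, d ≤ N → n ≤ N →
      ∑ j ∈ Finset.range (d + 1), d.choose j * fullMemCount j τ n = ∑ j ∈ Finset.range (N + 1), d.choose j * fullMemCount j τ n ∧
      ∑ j ∈ Finset.range (n + 1), d.choose j * fullMemCount j τ n = ∑ j ∈ Finset.range (N + 1), d.choose j * fullMemCount j τ n := by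
    intro N hdN hnN
    constructor
    · refine (Finset.sum_subset (Finset.range_subset_range.2 (by omega)) fun j hj hj' => ?_)
      rw [Finset.mem_range] at hj hj'
      rw [Nat.choose_eq_zero_of_lt (by omega), zero_mul]
    · refine (Finset.sum_subset (Finset.range_subset_range.2 (by omega)) fun j hj hj' => ?_)
      rw [Finset.mem_range] at hj hj'
      rw [fullMemCount_eq_zero_of_lt (by omega), mul_zero]
  obtain ⟨h1, h2⟩ := key (max d n) (le_max_left _ _) (le_max_right _ _)
  rw [h1, h2]

/-- **`d ↦ memCount d τ n` is a binomial polynomial of degree `≤ n`**, in real form. [folklore] -/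
theorem memCount_eq_sum_choose_real (d τ n : ℕ) :
    (memCount d τ n : ℝ) = ∑ j ∈ Finset.range (n + 1), (d.choose j : ℝ) * (fullMemCount j τ n : ℝ) := by
  rw [memCount_eq_sum_choose]; push_cast; rfl

end Summit.CriticalPhenomena.PercolationContinuityZ3.Theorems.Pcint.MemoryTail
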